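import Summits.AtomisticToContinuum.Crystallization.Theorems.HullExactificationCascadeRobustBarlowTemplateInjectiveCellsA
import Mathlib.Topology.Compactness.LocallyFinite

/-!
# Cell packages, part B (line `registered`, crux `RobustBarlowTemplate`, stmt-AtomisticToContinuum-12088)

Toward the registered stub `develop_injective` (the STAR ESTIMATE `injective_starApprox`): the
CELL PACKAGE `injective_good_of` of `…InjectiveCellCore.lean` instantiated for the last two of the six
closed cells of a prism `(k, i, j)` of the refined Barlow honeycomb (cell formulas of
`…HoneycombContinuousA.lean`, closedness from `…HoneycombContinuous.lean`).  For each cell: the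
membership predicate and the weights of `plData`, the four vertex index triples, and the VERTEX
ERROR MATRIX `M` (`1/20` for a contact pair, `61/190` for the diagonal pair `C–D` of a quarter
octahedron — `injective_far_CD/DC` — and `0` on the diagonal; row sums `3/20` or `8/19 ≤ 9/20`).

## Contents
* `injective_good_BF` — the cell quarter `{C, D, B, F}` (`F = (0,1,1)`);
* `injective_good_FE` — the cell quarter `{C, D, F, E}`;
* `injective_prisms_locallyFinite`, `injective_cover` — the closed prisms are locally finite; every
  compact set is covered by finitely many cells, each with its package (registered anchor
  `injective_cellCover`).
-/

noncomputable section

namespace Summit.AtomisticToContinuum.Crystallization.Theorems.HullExactificationCascadeRobustBarlowTemplate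

open Literature.MathematicalPhysics.StatisticalMechanics

/-- Euclidean `3`-space. -/
local notation "E3" => EuclideanSpace ℝ (Fin 3)

/-- CELL PACKAGE for the closed cell quarter `{C, D, B, F}` (`F = (0,1,1)`) of prism `(k, i, j)`: closed, convex,
hat functions `√2`-Lipschitz, star estimate `27/40 · l` from every vertex. -/
theorem injective_good_BF {s : ℤ → ℤ} (hs : IsHaggSeq s) (k i j : ℤ) :
    ∀ C : Set E3, C = {x : E3 | 0 ≤ toSkew s k x 0 - i ∧ toSkew s k x 1 - j ≤ 1 ∧ 1 ≤ (toSkew s k x 1 - j) + toSkew s k x 2 ∧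
        (toSkew s k x 0 - i) + toSkew s k x 2 ≤ 1} →
      IsClosed C ∧ Convex ℝ C ∧
      (∀ t₀ : ℤ × ℤ × ℤ, ∀ z ∈ C, ∀ z' ∈ C,
        |plExtend s (fun t => if t = t₀ then (1 : ℝ) else 0) z -
          plExtend s (fun t => if t = t₀ then (1 : ℝ) else 0) z'| ≤ Real.sqrt 2 * ‖z - z'‖) ∧
      (∀ Ψ : E3 → E3, LocSim s Ψ → ∀ (t₀ : ℤ × ℤ × ℤ) (A : E3 →ₗᵢ[ℝ] E3) (l : ℝ), 0 < l →
        (∀ q ∈ idealStacking s, dist q (siteAt s t₀) ≤ 1 →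
          dist (Ψ q) (Ψ (siteAt s t₀) + l • A (q - siteAt s t₀)) ≤ 1 / 20 * l) →
        (∃ y ∈ C, plExtend s (fun t => if t = t₀ then (1 : ℝ) else 0) y ≠ 0) →
        ∀ z ∈ C, ∀ z' ∈ C, ‖plExtend s (fun t => Ψ (siteAt s t)) z -
          plExtend s (fun t => Ψ (siteAt s t)) z' - l • A (z - z')‖ ≤ 27 / 40 * l * ‖z - z'‖) := by
  rintro C rfl
  refine injective_good_of hs k i j (fun a b θ => 0 ≤ a ∧ b ≤ 1 ∧ 1 ≤ b + θ ∧ a + θ ≤ 1)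
    ![fun a _ _ => a, fun _ b _ => 1 - b, fun a _ θ => 1 - a - θ, fun _ b θ => b + θ - 1]
    ![skewSite s k (i + 1) (j + 1) 0, skewSite s k i j 1, skewSite s k i (j + 1) 0, skewSite s k i (j + 1) 1]
    _ rfl (honeycomb_cellBF_continuousOn hs (fun _ => (0 : ℝ)) k i j).1 ?_ ?_ ?_ ?_ ?_ ?_
    ![![0, 61 / 190, 1 / 20, 1 / 20], ![61 / 190, 0, 1 / 20, 1 / 20], ![1 / 20, 1 / 20, 0, 1 / 20],
      ![1 / 20, 1 / 20, 1 / 20, 0]] ?_ ?_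
  · rintro a b θ a' b' θ' p q hp hq hpq ⟨h1, h2, h3, h4⟩ ⟨h1', h2', h3', h4'⟩
    refine ⟨?_, ?_, ?_, ?_⟩ <;> nlinarith [mul_nonneg hp (sub_nonneg.2 h1), mul_nonneg hq (sub_nonneg.2 h1'),
      mul_nonneg hp (sub_nonneg.2 h2), mul_nonneg hq (sub_nonneg.2 h2'), mul_nonneg hp (sub_nonneg.2 h3),
      mul_nonneg hq (sub_nonneg.2 h3'), mul_nonneg hp (sub_nonneg.2 h4), mul_nonneg hq (sub_nonneg.2 h4')]
  · rintro W _ _ g a b θ ⟨h1, h2, h3, h4⟩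
    rw [honeycomb_plExtend_cellBF hs g k i j a b θ h1 h2 h3 h4, Fin.sum_univ_four]
    simp
  · intro a b θ
    rw [Fin.sum_univ_four]
    simp only [Matrix.cons_val_zero, Matrix.cons_val_one, Matrix.cons_val]
    rw [honeycomb_siteAt_skewSite s k (i + 1) (j + 1) 0 (Or.inl rfl) hs,
      honeycomb_siteAt_skewSite s k i j 1 (Or.inr rfl) hs,
      honeycomb_siteAt_skewSite s k i (j + 1) 0 (Or.inl rfl) hs,
      honeycomb_siteAt_skewSite s k i (j + 1) 1 (Or.inr rfl) hs]
    simp only [ofSkew, Matrix.cons_val_zero, Matrix.cons_val_one, Matrix.cons_val]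
    push_cast
    module
  · intro a b θ
    simp only [Fin.sum_univ_four, Matrix.cons_val_zero, Matrix.cons_val_one, Matrix.cons_val]
    ring
  · intro m a b θ a' b' θ'
    obtain ⟨f1, f2, f3, f4, f5, f6, f7⟩ := injective_forms (a - a') (b - b') (θ - θ')
    rw [honeycomb_sqdist_ofSkew s k (hs k)]
    fin_cases m <;> simp <;> nlinarith [f1, f2, f3, f4, f5, f6, f7]
  · intro m m' h
    fin_cases m <;> fin_cases m' <;> simp [injective_skewSite_eq_iff (hs k)] at h ⊢
  · intro m₀
    fin_cases m₀ <;> simp [Fin.sum_univ_four] <;> norm_num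
  · intro Ψ hL m₀ A l hl hcl m
    fin_cases m₀ <;> fin_cases m <;>
      simp only [Matrix.cons_val_zero, Matrix.cons_val_one, Matrix.cons_val, Fin.isValue, Fin.mk_one,
        Fin.zero_eta, Fin.reduceFinMk] at hcl ⊢ <;>
      first
        | (simp; done)
        | (rw [← dist_eq_norm]
           exact hcl _ (injective_site_mem s _)
             (injective_site_dist_le_one hs k _ _ _ _ _ _ (by norm_num) (by norm_num) (by push_cast; ring)))
        | (rw [← dist_eq_norm]; exact injective_far_CD hs hL k i j A l hl hcl)
        | (rw [← dist_eq_norm]; exact injective_far_DC hs hL k i j A l hl hcl)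

/-- CELL PACKAGE for the closed cell quarter `{C, D, F, E}` of prism `(k, i, j)`: closed, convex,
hat functions `√2`-Lipschitz, star estimate `27/40 · l` from every vertex. -/
theorem injective_good_FE {s : ℤ → ℤ} (hs : IsHaggSeq s) (k i j : ℤ) :
    ∀ C : Set E3, C = {x : E3 | toSkew s k x 2 ≤ 1 ∧ (toSkew s k x 0 - i) + (toSkew s k x 1 - j) + toSkew s k x 2 ≤ 2 ∧
        1 ≤ (toSkew s k x 1 - j) + toSkew s k x 2 ∧ 1 ≤ (toSkew s k x 0 - i) + toSkew s k x 2} →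
      IsClosed C ∧ Convex ℝ C ∧
      (∀ t₀ : ℤ × ℤ × ℤ, ∀ z ∈ C, ∀ z' ∈ C,
        |plExtend s (fun t => if t = t₀ then (1 : ℝ) else 0) z -
          plExtend s (fun t => if t = t₀ then (1 : ℝ) else 0) z'| ≤ Real.sqrt 2 * ‖z - z'‖) ∧
      (∀ Ψ : E3 → E3, LocSim s Ψ → ∀ (t₀ : ℤ × ℤ × ℤ) (A : E3 →ₗᵢ[ℝ] E3) (l : ℝ), 0 < l →
        (∀ q ∈ idealStacking s, dist q (siteAt s t₀) ≤ 1 →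
          dist (Ψ q) (Ψ (siteAt s t₀) + l • A (q - siteAt s t₀)) ≤ 1 / 20 * l) →
        (∃ y ∈ C, plExtend s (fun t => if t = t₀ then (1 : ℝ) else 0) y ≠ 0) →
        ∀ z ∈ C, ∀ z' ∈ C, ‖plExtend s (fun t => Ψ (siteAt s t)) z -
          plExtend s (fun t => Ψ (siteAt s t)) z' - l • A (z - z')‖ ≤ 27 / 40 * l * ‖z - z'‖) := by
  rintro C rfl
  refine injective_good_of hs k i j (fun a b θ => θ ≤ 1 ∧ a + b + θ ≤ 2 ∧ 1 ≤ b + θ ∧ 1 ≤ a + θ)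
    ![fun _ _ θ => 1 - θ, fun a b θ => 2 - a - b - θ, fun _ b θ => b + θ - 1, fun a _ θ => a + θ - 1]
    ![skewSite s k (i + 1) (j + 1) 0, skewSite s k i j 1, skewSite s k i (j + 1) 1, skewSite s k (i + 1) j 1]
    _ rfl (honeycomb_cellFE_continuousOn hs (fun _ => (0 : ℝ)) k i j).1 ?_ ?_ ?_ ?_ ?_ ?_
    ![![0, 61 / 190, 1 / 20, 1 / 20], ![61 / 190, 0, 1 / 20, 1 / 20], ![1 / 20, 1 / 20, 0, 1 / 20],
      ![1 / 20, 1 / 20, 1 / 20, 0]] ?_ ?_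
  · rintro a b θ a' b' θ' p q hp hq hpq ⟨h1, h2, h3, h4⟩ ⟨h1', h2', h3', h4'⟩
    refine ⟨?_, ?_, ?_, ?_⟩ <;> nlinarith [mul_nonneg hp (sub_nonneg.2 h1), mul_nonneg hq (sub_nonneg.2 h1'),
      mul_nonneg hp (sub_nonneg.2 h2), mul_nonneg hq (sub_nonneg.2 h2'), mul_nonneg hp (sub_nonneg.2 h3),
      mul_nonneg hq (sub_nonneg.2 h3'), mul_nonneg hp (sub_nonneg.2 h4), mul_nonneg hq (sub_nonneg.2 h4')]
  · rintro W _ _ g a b θ ⟨h1, h2, h3, h4⟩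
    rw [honeycomb_plExtend_cellFE hs g k i j a b θ h1 h2 h3 h4, Fin.sum_univ_four]
    simp
  · intro a b θ
    rw [Fin.sum_univ_four]
    simp only [Matrix.cons_val_zero, Matrix.cons_val_one, Matrix.cons_val]
    rw [honeycomb_siteAt_skewSite s k (i + 1) (j + 1) 0 (Or.inl rfl) hs,
      honeycomb_siteAt_skewSite s k i j 1 (Or.inr rfl) hs,
      honeycomb_siteAt_skewSite s k i (j + 1) 1 (Or.inr rfl) hs,
      honeycomb_siteAt_skewSite s k (i + 1) j 1 (Or.inr rfl) hs]
    simp only [ofSkew, Matrix.cons_val_zero, Matrix.cons_val_one, Matrix.cons_val]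
    push_cast
    module
  · intro a b θ
    simp only [Fin.sum_univ_four, Matrix.cons_val_zero, Matrix.cons_val_one, Matrix.cons_val]
    ring
  · intro m a b θ a' b' θ'
    obtain ⟨f1, f2, f3, f4, f5, f6, f7⟩ := injective_forms (a - a') (b - b') (θ - θ')
    rw [honeycomb_sqdist_ofSkew s k (hs k)]
    fin_cases m <;> simp <;> nlinarith [f1, f2, f3, f4, f5, f6, f7]
  · intro m m' h
    fin_cases m <;> fin_cases m' <;> simp [injective_skewSite_eq_iff (hs k)] at h ⊢
  · intro m₀
    fin_cases m₀ <;> simp [Fin.sum_univ_four] <;> norm_num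
  · intro Ψ hL m₀ A l hl hcl m
    fin_cases m₀ <;> fin_cases m <;>
      simp only [Matrix.cons_val_zero, Matrix.cons_val_one, Matrix.cons_val, Fin.isValue, Fin.mk_one,
        Fin.zero_eta, Fin.reduceFinMk] at hcl ⊢ <;>
      first
        | (simp; done)
        | (rw [← dist_eq_norm]
           exact hcl _ (injective_site_mem s _)
             (injective_site_dist_le_one hs k _ _ _ _ _ _ (by norm_num) (by norm_num) (by push_cast; ring)))
        | (rw [← dist_eq_norm]; exact injective_far_CD hs hL k i j A l hl hcl)
        | (rw [← dist_eq_norm]; exact injective_far_DC hs hL k i j A l hl hcl)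

/-! ## Local finiteness of the prisms and the finite cell cover of a compact set -/

/-- The closed prisms `[i, i+1] × [j, j+1] × [0, 1]` (skew coordinates of slab `k`), indexed by
`(k, i, j)`, form a locally finite family of subsets of `ℝ³`. -/
theorem injective_prisms_locallyFinite (s : ℤ → ℤ) :
    LocallyFinite fun q : ℤ × ℤ × ℤ => {x : E3 | 0 ≤ toSkew s q.1 x 0 - q.2.1 ∧
      toSkew s q.1 x 0 - q.2.1 ≤ 1 ∧ 0 ≤ toSkew s q.1 x 1 - q.2.2 ∧ toSkew s q.1 x 1 - q.2.2 ≤ 1 ∧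
      0 ≤ toSkew s q.1 x 2 ∧ toSkew s q.1 x 2 ≤ 1} := by
  intro x
  have hcoord : Continuous fun x : E3 => x 2 / hB := by fun_prop
  obtain ⟨U₁, hU₁, hfin⟩ := (honeycomb_locallyFinite_Icc.preimage_continuous hcoord) x
  have hbox := fun k : ℤ =>
    (honeycomb_locallyFinite_box.preimage_continuous (honeycomb_continuous_toSkew s k)) x
  choose V hV hVf using hbox
  set Kx := {n : ℤ | ((fun n : ℤ => (fun x : E3 => x 2 / hB) ⁻¹' Set.Icc (n : ℝ) (n + 1)) n ∩ U₁).Nonempty}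
    with hKx
  refine ⟨U₁ ∩ ⋂ k ∈ Kx, V k, Filter.inter_mem hU₁ ((Filter.biInter_mem hfin).2 fun k _ => hV k), ?_⟩
  refine (hfin.biUnion fun k _ => (hVf k).image fun p : ℤ × ℤ => ((k, p) : ℤ × ℤ × ℤ)).subset ?_
  rintro ⟨k, i, j⟩ ⟨y, ⟨h0, h1, h2, h3, h4, h5⟩, hyU, hyV⟩
  have hθ : toSkew s k y 2 = y 2 / hB - k := honeycomb_toSkew_apply_two s k y
  have hk : k ∈ Kx := by
    refine ⟨y, ?_, hyU⟩
    simp only [Set.mem_preimage, Set.mem_Icc]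
    constructor <;> linarith
  refine Set.mem_iUnion₂.2 ⟨k, hk, (i, j), ⟨y, ?_, Set.mem_iInter₂.1 hyV k hk⟩, rfl⟩
  simp only [Set.mem_preimage, Set.mem_setOf_eq]
  exact ⟨by linarith, by linarith, by linarith, by linarith⟩

/-- THE FINITE CELL COVER: every compact subset of `ℝ³` is covered by finitely many closed cells
of the refined honeycomb, each coming with its cell package (closed, convex, hat functions
`√2`-Lipschitz, star estimate from every detected vertex). -/
theorem injective_cover {s : ℤ → ℤ} (hs : IsHaggSeq s) (K : Set E3) (hK : IsCompact K) :
    ∃ 𝒞 : Set (Set E3), 𝒞.Finite ∧ K ⊆ ⋃₀ 𝒞 ∧ ∀ C ∈ 𝒞,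
      IsClosed C ∧ Convex ℝ C ∧
      (∀ t₀ : ℤ × ℤ × ℤ, ∀ z ∈ C, ∀ z' ∈ C,
        |plExtend s (fun t => if t = t₀ then (1 : ℝ) else 0) z -
          plExtend s (fun t => if t = t₀ then (1 : ℝ) else 0) z'| ≤ Real.sqrt 2 * ‖z - z'‖) ∧
      (∀ Ψ : E3 → E3, LocSim s Ψ → ∀ (t₀ : ℤ × ℤ × ℤ) (A : E3 →ₗᵢ[ℝ] E3) (l : ℝ), 0 < l →
        (∀ q ∈ idealStacking s, dist q (siteAt s t₀) ≤ 1 →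
          dist (Ψ q) (Ψ (siteAt s t₀) + l • A (q - siteAt s t₀)) ≤ 1 / 20 * l) →
        (∃ y ∈ C, plExtend s (fun t => if t = t₀ then (1 : ℝ) else 0) y ≠ 0) →
        ∀ z ∈ C, ∀ z' ∈ C, ‖plExtend s (fun t => Ψ (siteAt s t)) z -
          plExtend s (fun t => Ψ (siteAt s t)) z' - l • A (z - z')‖ ≤ 27 / 40 * l * ‖z - z'‖) := by
  have hQ := (injective_prisms_locallyFinite s).finite_nonempty_inter_compact hK
  refine ⟨⋃ q ∈ {q : ℤ × ℤ × ℤ | ({x : E3 | 0 ≤ toSkew s q.1 x 0 - q.2.1 ∧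
      toSkew s q.1 x 0 - q.2.1 ≤ 1 ∧ 0 ≤ toSkew s q.1 x 1 - q.2.2 ∧ toSkew s q.1 x 1 - q.2.2 ≤ 1 ∧
      0 ≤ toSkew s q.1 x 2 ∧ toSkew s q.1 x 2 ≤ 1} ∩ K).Nonempty},
    ({{x : E3 | 0 ≤ toSkew s q.1 x 0 - q.2.1 ∧ 0 ≤ toSkew s q.1 x 1 - q.2.2 ∧ 0 ≤ toSkew s q.1 x 2 ∧
        (toSkew s q.1 x 0 - q.2.1) + (toSkew s q.1 x 1 - q.2.2) + toSkew s q.1 x 2 ≤ 1},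
      {x : E3 | toSkew s q.1 x 0 - q.2.1 ≤ 1 ∧ toSkew s q.1 x 1 - q.2.2 ≤ 1 ∧ toSkew s q.1 x 2 ≤ 1 ∧
        2 ≤ (toSkew s q.1 x 0 - q.2.1) + (toSkew s q.1 x 1 - q.2.2) + toSkew s q.1 x 2},
      {x : E3 | 0 ≤ toSkew s q.1 x 2 ∧ 1 ≤ (toSkew s q.1 x 0 - q.2.1) + (toSkew s q.1 x 1 - q.2.2) + toSkew s q.1 x 2 ∧
        (toSkew s q.1 x 1 - q.2.2) + toSkew s q.1 x 2 ≤ 1 ∧ (toSkew s q.1 x 0 - q.2.1) + toSkew s q.1 x 2 ≤ 1},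
      {x : E3 | 0 ≤ toSkew s q.1 x 1 - q.2.2 ∧ toSkew s q.1 x 0 - q.2.1 ≤ 1 ∧
        (toSkew s q.1 x 1 - q.2.2) + toSkew s q.1 x 2 ≤ 1 ∧ 1 ≤ (toSkew s q.1 x 0 - q.2.1) + toSkew s q.1 x 2},
      {x : E3 | 0 ≤ toSkew s q.1 x 0 - q.2.1 ∧ toSkew s q.1 x 1 - q.2.2 ≤ 1 ∧
        1 ≤ (toSkew s q.1 x 1 - q.2.2) + toSkew s q.1 x 2 ∧ (toSkew s q.1 x 0 - q.2.1) + toSkew s q.1 x 2 ≤ 1},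
      {x : E3 | toSkew s q.1 x 2 ≤ 1 ∧ (toSkew s q.1 x 0 - q.2.1) + (toSkew s q.1 x 1 - q.2.2) + toSkew s q.1 x 2 ≤ 2 ∧
        1 ≤ (toSkew s q.1 x 1 - q.2.2) + toSkew s q.1 x 2 ∧ 1 ≤ (toSkew s q.1 x 0 - q.2.1) + toSkew s q.1 x 2}} :
      Set (Set E3)), hQ.biUnion fun q _ => Set.toFinite _, ?_, ?_⟩
  · -- the cells cover `K`
    intro y hy
    set k : ℤ := slabOf y with hk
    have hθ : toSkew s k y 2 = y 2 / hB - k := honeycomb_toSkew_apply_two s k y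
    have hk0 : (k : ℝ) ≤ y 2 / hB := Int.floor_le _
    have hk1 : y 2 / hB < k + 1 := Int.lt_floor_add_one _
    set i : ℤ := ⌊toSkew s k y 0⌋ with hi
    set j : ℤ := ⌊toSkew s k y 1⌋ with hj
    have ha0 : (i : ℝ) ≤ toSkew s k y 0 := Int.floor_le _
    have ha1 : toSkew s k y 0 < i + 1 := Int.lt_floor_add_one _
    have hb0 : (j : ℝ) ≤ toSkew s k y 1 := Int.floor_le _
    have hb1 : toSkew s k y 1 < j + 1 := Int.lt_floor_add_one _
    have hq : ((k, i, j) : ℤ × ℤ × ℤ) ∈ {q : ℤ × ℤ × ℤ | ({x : E3 | 0 ≤ toSkew s q.1 x 0 - q.2.1 ∧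
        toSkew s q.1 x 0 - q.2.1 ≤ 1 ∧ 0 ≤ toSkew s q.1 x 1 - q.2.2 ∧ toSkew s q.1 x 1 - q.2.2 ≤ 1 ∧
        0 ≤ toSkew s q.1 x 2 ∧ toSkew s q.1 x 2 ≤ 1} ∩ K).Nonempty} :=
      ⟨y, ⟨by linarith, by linarith, by linarith, by linarith, by linarith, by linarith⟩, hy⟩
    refine Set.mem_sUnion.2 ?_
    by_cases c1 : (toSkew s k y 0 - i) + (toSkew s k y 1 - j) + toSkew s k y 2 ≤ 1
    · exact ⟨_, Set.mem_biUnion hq (Set.mem_insert _ _), by linarith, by linarith, by linarith, c1⟩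
    by_cases c2 : 2 ≤ (toSkew s k y 0 - i) + (toSkew s k y 1 - j) + toSkew s k y 2
    · exact ⟨_, Set.mem_biUnion hq (Set.mem_insert_of_mem _ (Set.mem_insert _ _)),
        by linarith, by linarith, by linarith, c2⟩
    by_cases c3 : (toSkew s k y 1 - j) + toSkew s k y 2 ≤ 1
    · by_cases c4 : (toSkew s k y 0 - i) + toSkew s k y 2 ≤ 1
      · exact ⟨_, Set.mem_biUnion hq (Set.mem_insert_of_mem _ (Set.mem_insert_of_mem _ (Set.mem_insert _ _))),
          by linarith, by linarith, c3, c4⟩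
      · exact ⟨_, Set.mem_biUnion hq (Set.mem_insert_of_mem _ (Set.mem_insert_of_mem _
          (Set.mem_insert_of_mem _ (Set.mem_insert _ _)))), by linarith, by linarith, c3, by linarith⟩
    · by_cases c4 : (toSkew s k y 0 - i) + toSkew s k y 2 ≤ 1
      · exact ⟨_, Set.mem_biUnion hq (Set.mem_insert_of_mem _ (Set.mem_insert_of_mem _
          (Set.mem_insert_of_mem _ (Set.mem_insert_of_mem _ (Set.mem_insert _ _))))),
          by linarith, by linarith, by linarith, c4⟩
      · exact ⟨_, Set.mem_biUnion hq (Set.mem_insert_of_mem _ (Set.mem_insert_of_mem _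
          (Set.mem_insert_of_mem _ (Set.mem_insert_of_mem _ (Set.mem_insert_of_mem _ rfl))))),
          by linarith, by linarith, by linarith, by linarith⟩
  · -- every cell of the cover has its package
    intro C hC
    obtain ⟨⟨k, i, j⟩, -, hC⟩ := Set.mem_iUnion₂.1 hC
    simp only [Set.mem_insert_iff, Set.mem_singleton_iff] at hC
    rcases hC with rfl | rfl | rfl | rfl | rfl | rfl
    · exact injective_good_up hs k i j _ rfl
    · exact injective_good_down hs k i j _ rfl
    · exact injective_good_AB hs k i j _ rfl
    · exact injective_good_EA hs k i j _ rfl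
    · exact injective_good_BF hs k i j _ rfl
    · exact injective_good_FE hs k i j _ rfl

/-- SUB-GOAL (registered anchor `injective_cellCover`): the finite cell cover of a compact set, with
the star-estimate clause of each cell's package. -/
theorem injective_cellCover : ∀ (s : ℤ → ℤ), IsHaggSeq s → ∀ K : Set E3, IsCompact K → ∃ 𝒞 : Set (Set E3), 𝒞.Finite ∧ K ⊆ ⋃₀ 𝒞 ∧ ∀ C ∈ 𝒞, IsClosed C ∧ Convex ℝ C ∧ (∀ Ψ : E3 → E3, LocSim s Ψ → ∀ (t₀ : ℤ × ℤ × ℤ) (A : E3 →ₗᵢ[ℝ] E3) (l : ℝ), 0 < l → (∀ q ∈ idealStacking s, dist q (siteAt s t₀) ≤ 1 → dist (Ψ q) (Ψ (siteAt s t₀) + l • A (q - siteAt s t₀)) ≤ 1 / 20 * l) → (∃ y ∈ C, plExtend s (fun t => if t = t₀ then (1 : ℝ) else 0) y ≠ 0) → ∀ z ∈ C, ∀ z' ∈ C, ‖plExtend s (fun t => Ψ (siteAt s t)) z - plExtend s (fun t => Ψ (siteAt s t)) z' - l • A (z - z')‖ ≤ 27 / 40 * l * ‖z - z'‖) := by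
  intro s hs K hK
  obtain ⟨𝒞, h1, h2, h3⟩ := injective_cover hs K hK
  exact ⟨𝒞, h1, h2, fun C hC => ⟨(h3 C hC).1, (h3 C hC).2.1, (h3 C hC).2.2.2⟩⟩

end Summit.AtomisticToContinuum.Crystallization.Theorems.HullExactificationCascadeRobustBarlowTemplate

end
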